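import Summits.AtomisticToContinuum.Crystallization.Theorems.UniformPolytypeStability.Negative.Rows
import Summits.AtomisticToContinuum.Crystallization.Theorems.UniformPolytypeStability.Negative.Membrane
import Mathlib.Analysis.Normed.Group.Tannery

/-!
# `UniformPolytypeStability` (stmt-AtomisticToContinuum-15800), negative side IV-b: the upper height bound is load-bearing

Part IV-b of the standing disprover's load-bearing analysis of crux `UniformPolytypeStability`
(route `DisclinationRation`): on the crux's parameter box with the UPPER layer-spacing bound
`z(m+1) − z(m) ≤ 17a/20` deleted (everything else kept: `47/50 ≤ a ≤ 1`, Hägg sequence, lower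
spacing bound, force balance, finite support), uniform polytype stability is FALSE
(`uniformPolytypeStability_false_without_heightUpper`).

Witness: `a = a₀ = 47/50`, the fcc word `constHagg`, uniform heights `z = H·m`, the vertical
single-site displacement `u = e₃·𝟙_{0}`.  By parts I–II the site set is the fcc lattice, it is
force balanced, and `hessForm = 2·Σ'_n hr(Y_H(n))` over lattice labels `n = (i,j,m)`.  As
`H → ∞` the layers decouple (Tannery's theorem over the lattice at `H = 1`, dominated by
`904‖Y_1(n)‖⁻⁸`): the limit is the basal-layer sum, which is the transverse stiffness
`Σ_{η≠0} V′(|η|)/|η|` of a triangular LJ membrane compressed to spacing `0.94`, and that is `< −3/2`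
by part IV-a (`tsum_ψpl_lt`).  Hence `hessForm < 0 ≤ κ·nnForm` for some `H ≥ 1`.  All `[folklore]`.
-/

noncomputable section

namespace Summit.AtomisticToContinuum.Crystallization.Theorems.UniformPolytypeStabilityNegative

open scoped BigOperators Topology Classical InnerProductSpace
open Filter Set Function
open Literature.MathematicalPhysics.StatisticalMechanics
open Summit.AtomisticToContinuum.Crystallization.Theorems.PhononStabilityNegative

local notation "E3" => EuclideanSpace ℝ (Fin 3)

/-! ## §7 The fcc word at large uniform layer spacing: the UPPER height bound is load-bearing -/

section HeightUpper

/-- The vertical unit vector `e₃`. [folklore] -/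
def e₃ : E3 := EuclideanSpace.single 2 (1 : ℝ)

/-- `‖e₃‖ = 1`. [folklore] -/
theorem norm_e₃ : ‖e₃‖ = 1 := by
  rw [e₃, PiLp.norm_single, norm_one]

/-- `⟪x, e₃⟫ = x₃`. [folklore] -/
theorem inner_e₃ (x : E3) : inner ℝ x e₃ = x 2 := by
  rw [e₃, EuclideanSpace.inner_single_right]; simp

/-- `a₀ ≠ 0`. [folklore] -/
theorem a₀_ne_zero : a₀ ≠ 0 := by unfold a₀; norm_num

/-- The labelled vector `Y_H(i,j,m) = i u + j v + m w + m H e₃` of the fcc lattice with in-layer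
spacing `a₀` and uniform layer spacing `H`. [folklore] -/
def Y (H : ℝ) (n : ℤ × ℤ × ℤ) : E3 := barlowPos a₀ H constHagg n.2.2 n.1 n.2.1

/-- First coordinate of `Y`. [folklore] -/
theorem Y_apply_zero (H : ℝ) (n : ℤ × ℤ × ℤ) :
    Y H n 0 = a₀ * (n.1 + n.2.1 / 2 + n.2.2 / 2) := by
  simp [Y]

/-- Second coordinate of `Y`. [folklore] -/
theorem Y_apply_one (H : ℝ) (n : ℤ × ℤ × ℤ) :
    Y H n 1 = a₀ * √3 / 2 * (n.2.1 + n.2.2 / 3) := by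
  simp [Y]

/-- Third coordinate of `Y`. [folklore] -/
theorem Y_apply_two (H : ℝ) (n : ℤ × ℤ × ℤ) : Y H n 2 = n.2.2 * H := by
  simp [Y]

/-- `Y_H(0) = 0`. [folklore] -/
theorem Y_zero (H : ℝ) : Y H 0 = 0 := by
  simp [Y, barlowPos]

/-- `Y_H(n)` is a vector of the fcc lattice `fccLat a₀ H`. [folklore] -/
theorem Y_mem {H : ℝ} (hH : H ≠ 0) (n : ℤ × ℤ × ℤ) : Y H n ∈ fccLat a₀_ne_zero hH :=
  (mem_fccLat_iff a₀_ne_zero hH _).2 ⟨n.2.2, n.1, n.2.1, by simp only [Y, barlowPos, haggLabel_const]⟩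

/-- Every fcc lattice vector is labelled. [folklore] -/
theorem exists_Y_eq {H : ℝ} (hH : H ≠ 0) {g : E3} (hg : g ∈ fccLat a₀_ne_zero hH) :
    ∃ n, Y H n = g := by
  obtain ⟨m, i, j, rfl⟩ := (mem_fccLat_iff a₀_ne_zero hH g).1 hg
  exact ⟨(i, j, m), by simp only [Y, barlowPos, haggLabel_const]⟩

/-- Labels are unique. [folklore] -/
theorem Y_injective {H : ℝ} (hH : H ≠ 0) : Function.Injective (Y H) := by
  rintro ⟨i, j, m⟩ ⟨i', j', m'⟩ h
  have h2 := congrArg (fun x : E3 => x 2) h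
  have h1 := congrArg (fun x : E3 => x 1) h
  have h0 := congrArg (fun x : E3 => x 0) h
  simp only [Y_apply_two, Y_apply_one, Y_apply_zero] at h0 h1 h2
  have ha : (0 : ℝ) < a₀ := by unfold a₀; norm_num
  have h3 : (0 : ℝ) < √3 := Real.sqrt_pos.2 (by norm_num)
  have hm : (m : ℝ) = m' := mul_right_cancel₀ hH h2
  have hj : (j : ℝ) = j' := by
    have := mul_left_cancel₀ (show a₀ * √3 / 2 ≠ 0 by positivity) h1
    linarith
  have hi : (i : ℝ) = i' := by
    have := mul_left_cancel₀ ha.ne' h0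
    linarith
  have hm' : m = m' := by exact_mod_cast hm
  have hj' : j = j' := by exact_mod_cast hj
  have hi' : i = i' := by exact_mod_cast hi
  rw [hm', hj', hi']

/-- `‖Y_H(i,j,m)‖² = a₀²(i + j/2 + m/2)² + (3a₀²/4)(j + m/3)² + m²H²`. [folklore] -/
theorem norm_sq_Y (H : ℝ) (n : ℤ × ℤ × ℤ) :
    ‖Y H n‖ ^ 2 = (a₀ * (n.1 + n.2.1 / 2 + n.2.2 / 2)) ^ 2 +
      (a₀ * √3 / 2 * (n.2.1 + n.2.2 / 3)) ^ 2 + (n.2.2 * H) ^ 2 := by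
  rw [EuclideanSpace.norm_sq_eq, Fin.sum_univ_three, Y_apply_zero, Y_apply_one, Y_apply_two]
  simp only [Real.norm_eq_abs, sq_abs]

/-- In-plane vectors do not see `H`. [folklore] -/
theorem Y_planar (H : ℝ) (i j : ℤ) : Y H (i, j, 0) = Y 1 (i, j, 0) := by
  ext k
  fin_cases k <;> simp [Y]

/-- `‖i u + j v‖² = a₀²(i² + ij + j²)`. [folklore] -/
theorem norm_sq_Y_planar (H : ℝ) (i j : ℤ) : ‖Y H (i, j, 0)‖ ^ 2 = a₀ ^ 2 * (Qf (i, j) : ℝ) := by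
  have h3 : (√3 : ℝ) ^ 2 = 3 := Real.sq_sqrt (by norm_num)
  rw [norm_sq_Y]
  simp only [Qf]
  push_cast
  linear_combination (a₀ ^ 2 * (j : ℝ) ^ 2 / 4) * h3

/-- The norm of a labelled vector is monotone in `H ≥ 1`. [folklore] -/
theorem norm_Y_one_le {H : ℝ} (hH : 1 ≤ H) (n : ℤ × ℤ × ℤ) : ‖Y 1 n‖ ≤ ‖Y H n‖ := by
  have hH2 : (1 : ℝ) ≤ H ^ 2 := by nlinarith
  have hsq : ‖Y 1 n‖ ^ 2 ≤ ‖Y H n‖ ^ 2 := by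
    rw [norm_sq_Y, norm_sq_Y]
    nlinarith [mul_nonneg (sq_nonneg (n.2.2 : ℝ)) (sub_nonneg.2 hH2)]
  exact le_of_pow_le_pow_left₀ two_ne_zero (norm_nonneg _) hsq

/-- Vectors off the basal layer are at least `H` long. [folklore] -/
theorem le_norm_Y (H : ℝ) {n : ℤ × ℤ × ℤ} (hm : n.2.2 ≠ 0) : H ≤ ‖Y H n‖ := by
  have hm1 : (1 : ℝ) ≤ (n.2.2 : ℝ) ^ 2 := by
    have h : (1 : ℤ) ≤ n.2.2 ^ 2 := by nlinarith [Int.one_le_abs hm, sq_abs n.2.2]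
    exact_mod_cast h
  have hsq : H ^ 2 ≤ ‖Y H n‖ ^ 2 := by
    rw [norm_sq_Y]
    nlinarith [sq_nonneg (a₀ * (n.1 + n.2.1 / 2 + n.2.2 / 2)),
      sq_nonneg (a₀ * √3 / 2 * (n.2.1 + n.2.2 / 3)), mul_nonneg (sub_nonneg.2 hm1) (sq_nonneg H)]
  exact le_of_pow_le_pow_left₀ two_ne_zero (norm_nonneg _) hsq

/-- For `H ≥ 1` nonzero vectors are at least `1/2` long (`‖g‖ ≥ min a₀ H = a₀`). [folklore] -/
theorem half_le_norm_Y {H : ℝ} (hH : 1 ≤ H) {n : ℤ × ℤ × ℤ} (hn : Y H n ≠ 0) :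
    (1 / 2 : ℝ) ≤ ‖Y H n‖ := by
  have hH0 : (0 : ℝ) < H := by linarith
  have ha : (0 : ℝ) < a₀ := by unfold a₀; norm_num
  have h := min_le_norm_of_mem_fccLat ha hH0 (Y_mem hH0.ne' n) hn
  have : (1 / 2 : ℝ) ≤ min a₀ H := le_min (by unfold a₀; norm_num) (by linarith)
  linarith

/-- The row weight `hr(x) = e₃ᵀK(x)e₃` of the vertical single-site displacement (`0` at the
origin). [folklore] -/
def hr (x : E3) : ℝ := if x = 0 then 0 else Hess₀ x e₃

/-- `hr 0 = 0`. [folklore] -/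
theorem hr_zero : hr 0 = 0 := if_pos rfl

/-- `|hr(x)| ≤ 904‖x‖⁻⁸` (at `x = 0` or `‖x‖ ≥ 1/2`). [folklore] -/
theorem abs_hr_le {x : E3} (hx : x = 0 ∨ (1 / 2 : ℝ) ≤ ‖x‖) : |hr x| ≤ 904 * (‖x‖⁻¹) ^ 8 := by
  unfold hr
  rcases eq_or_ne x 0 with rfl | hne
  · simp
  · rw [if_neg hne]
    exact abs_Hess₀_le_inv_pow (hx.resolve_left hne) norm_e₃

/-- On the basal layer the row weight is the planar transverse weight of part IV-a:
`hr(i u + j v) = V′(r)/r = ψ(i² + ij + j²)`. [folklore] -/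
theorem hr_Y_planar (i j : ℤ) : hr (Y 1 (i, j, 0)) = ψpl (i, j) := by
  unfold hr ψpl
  by_cases h0 : ((i, j) : ℤ × ℤ) = 0
  · have hi : i = 0 := congrArg Prod.fst h0
    have hj : j = 0 := congrArg Prod.snd h0
    subst hi hj
    have hY : Y 1 ((0 : ℤ), (0 : ℤ), (0 : ℤ)) = 0 := by simp [Y, barlowPos]
    rw [if_pos hY, if_pos h0]
  · have hY : Y 1 (i, j, 0) ≠ 0 := by
      intro h
      have h' := Y_injective one_ne_zero (h.trans (Y_zero 1).symm)
      apply h0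
      simp only [Prod.ext_iff, Prod.fst_zero, Prod.snd_zero] at h' ⊢
      exact ⟨h'.1, h'.2.1⟩
    rw [if_neg hY, if_neg h0]
    have hin : inner ℝ (Y 1 (i, j, 0)) e₃ = 0 := by
      rw [inner_e₃, Y_apply_two]; simp
    rw [Hess₀_of_inner_eq_zero hin, norm_e₃, one_pow, mul_one]
    have hr0 : ‖Y 1 (i, j, 0)‖ ≠ 0 := norm_ne_zero_iff.2 hY
    rw [deriv_lennardJones hr0]
    unfold ψQ
    rw [← norm_sq_Y_planar 1 i j, ← inv_pow, div_eq_mul_inv]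
    ring

/-- Reindexing the lattice row sum by labels. [folklore] -/
theorem tsum_Hrow_fccLat_eq {H : ℝ} (hH : H ≠ 0) :
    ∑' y : fccLat a₀_ne_zero hH, Hrow (fccLat a₀_ne_zero hH) e₃ y =
      ∑' n : ℤ × ℤ × ℤ, hr (Y H n) := by
  set L := fccLat a₀_ne_zero hH
  let φ : ℤ × ℤ × ℤ → L := fun n => ⟨Y H n, Y_mem hH n⟩
  have hφ : Function.Injective φ := fun n n' h =>
    Y_injective hH (congrArg (fun y : L => (y : E3)) h)
  have hsupp : Function.support (Hrow L e₃) ⊆ Set.range φ := by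
    intro y _
    obtain ⟨n, hn⟩ := exists_Y_eq hH y.2
    exact ⟨n, Subtype.ext hn⟩
  rw [← hφ.tsum_eq hsupp]
  refine tsum_congr fun n => ?_
  simp only [Hrow, hr, φ, Submodule.mk_eq_zero]

/-- **Second variation of `e₃·𝟙_{0}` on the fcc lattice with layer spacing `H ≥ 1`:**
`hessForm = 2·Σ'_n hr(Y_H(n))`. [folklore] -/
theorem hessForm_e₃_eq {H : ℝ} (hH : 1 ≤ H) :
    hessForm a₀ constHagg (zU H) (uS e₃) = 2 * ∑' n : ℤ × ℤ × ℤ, hr (Y H n) := by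
  have hH0 : H ≠ 0 := by positivity
  have hS := sites_const_zU a₀_ne_zero hH0
  have hmin : ∀ y ∈ fccLat a₀_ne_zero hH0, y ≠ 0 → (1 / 2 : ℝ) ≤ ‖y‖ := by
    intro y hy hy0
    obtain ⟨n, rfl⟩ := exists_Y_eq hH0 hy
    exact half_le_norm_Y hH hy0
  rw [hessForm_single (fccLat a₀_ne_zero hH0) (finrank_fccLat _ _) hS hmin norm_e₃,
    tsum_Hrow_fccLat_eq hH0]

/-- The decoupled-layer limit of the row weights: the basal layer only. [folklore] -/
def gpl (n : ℤ × ℤ × ℤ) : ℝ := if n.2.2 = 0 then hr (Y 1 n) else 0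

/-- **Layer decoupling (Tannery):** as `H → ∞` the row sum of `e₃·𝟙_{0}` on the fcc lattice of
layer spacing `H` tends to its basal-layer part; the other layers are dominated by
`904‖Y_1(n)‖⁻⁸` (summable over the lattice at `H = 1`) and tend to `0` termwise (`‖Y_H(n)‖ ≥ H`).
[folklore] -/
theorem tendsto_tsum_hr :
    Tendsto (fun H : ℝ => ∑' n : ℤ × ℤ × ℤ, hr (Y H n)) atTop (𝓝 (∑' n, gpl n)) := by
  have h_sum : Summable fun n : ℤ × ℤ × ℤ => 904 * (‖Y 1 n‖⁻¹) ^ 8 := by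
    set L := fccLat a₀_ne_zero one_ne_zero
    let φ : ℤ × ℤ × ℤ → L := fun n => ⟨Y 1 n, Y_mem one_ne_zero n⟩
    have hφ : Function.Injective φ := fun n n' h =>
      Y_injective one_ne_zero (congrArg (fun y : L => (y : E3)) h)
    have h8 := ZLattice.summable_norm_sub_inv_pow L 8 (by rw [finrank_fccLat]; norm_num) 0
    have h8' := (h8.comp_injective hφ).mul_left 904
    refine h8'.congr fun n => ?_
    simp [φ]
  refine tendsto_tsum_of_dominated_convergence (f := fun H n => hr (Y H n)) h_sum ?_ ?_
  · intro n
    by_cases hm : n.2.2 = 0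
    · have hc : ∀ H, Y H n = Y 1 n := fun H => by
        obtain ⟨i, j, m⟩ := n
        simp only at hm
        subst hm
        exact Y_planar H i j
      simp only [gpl, if_pos hm, hc]
      exact tendsto_const_nhds
    · simp only [gpl, if_neg hm]
      refine squeeze_zero_norm' ?_ (by simpa using tendsto_inv_atTop_zero.const_mul (904 : ℝ))
      filter_upwards [eventually_ge_atTop (1 : ℝ)] with H hH
      rw [Real.norm_eq_abs]
      have hHle : H ≤ ‖Y H n‖ := le_norm_Y H hm
      have hY0 : Y H n ≠ 0 := by
        intro h0; rw [h0, norm_zero] at hHle; linarith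
      have h1 : |hr (Y H n)| ≤ 904 * (‖Y H n‖⁻¹) ^ 8 := abs_hr_le (Or.inr (half_le_norm_Y hH hY0))
      have hinv : ‖Y H n‖⁻¹ ≤ H⁻¹ := inv_anti₀ (by linarith) hHle
      have hinv1 : ‖Y H n‖⁻¹ ≤ 1 := inv_le_one_of_one_le₀ (le_trans hH hHle)
      have hinv0 : 0 ≤ ‖Y H n‖⁻¹ := inv_nonneg.2 (norm_nonneg _)
      have h8 : (‖Y H n‖⁻¹) ^ 8 ≤ ‖Y H n‖⁻¹ := pow_le_of_le_one hinv0 hinv1 (by norm_num)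
      linarith
  · filter_upwards [eventually_ge_atTop (1 : ℝ)] with H hH
    intro n
    rw [Real.norm_eq_abs]
    by_cases hn : Y H n = 0
    · rw [hn, hr_zero, abs_zero]; positivity
    · have hY1 : Y 1 n ≠ 0 := by
        intro h0
        have : n = 0 := Y_injective one_ne_zero (h0.trans (Y_zero 1).symm)
        subst this
        exact hn (Y_zero H)
      have hpos : 0 < ‖Y 1 n‖ := norm_pos_iff.2 hY1
      have hle : ‖Y H n‖⁻¹ ≤ ‖Y 1 n‖⁻¹ := inv_anti₀ hpos (norm_Y_one_le hH n)
      have hinv0 : 0 ≤ ‖Y H n‖⁻¹ := inv_nonneg.2 (norm_nonneg _)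
      calc |hr (Y H n)| ≤ 904 * (‖Y H n‖⁻¹) ^ 8 := abs_hr_le (Or.inr (half_le_norm_Y hH hn))
        _ ≤ 904 * (‖Y 1 n‖⁻¹) ^ 8 := by gcongr

/-- The limit row sum is the planar transverse sum of part IV-a. [folklore] -/
theorem tsum_gpl_eq : ∑' n, gpl n = ∑' p : ℤ × ℤ, ψpl p := by
  let e : ℤ × ℤ → ℤ × ℤ × ℤ := fun p => (p.1, p.2, 0)
  have he : Function.Injective e := fun p q h => by
    simp only [e, Prod.mk.injEq] at h
    exact Prod.ext h.1 h.2.1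
  have hsupp : Function.support gpl ⊆ Set.range e := by
    intro n hn
    rw [Function.mem_support] at hn
    by_cases hm : n.2.2 = 0
    · refine ⟨(n.1, n.2.1), ?_⟩
      obtain ⟨i, j, m⟩ := n
      simp only at hm
      subst hm
      rfl
    · exact absurd (if_neg hm) hn
  rw [← he.tsum_eq hsupp]
  refine tsum_congr fun p => ?_
  obtain ⟨i, j⟩ := p
  simp only [gpl, e]
  exact hr_Y_planar i j

/-- **Some layer spacing `H ≥ 1` makes the second variation negative.** [folklore] -/
theorem exists_height_tsum_hr_neg : ∃ H : ℝ, 1 ≤ H ∧ ∑' n : ℤ × ℤ × ℤ, hr (Y H n) < 0 := by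
  have hlim := tendsto_tsum_hr
  rw [tsum_gpl_eq] at hlim
  have hneg : ∑' p : ℤ × ℤ, ψpl p < 0 := by linarith [tsum_ψpl_lt]
  have hev : ∀ᶠ H in atTop, ∑' n : ℤ × ℤ × ℤ, hr (Y H n) < 0 := hlim.eventually (gt_mem_nhds hneg)
  obtain ⟨H, hH⟩ := (hev.and (eventually_ge_atTop 1)).exists
  exact ⟨H, hH.2, hH.1⟩

/-- **The UPPER height bound `z(m+1) − z(m) ≤ 17a/20` is load-bearing.**  On the window
`47/50 ≤ a ∧ a ≤ 1 ∧ IsHaggSeq s ∧ ∀ m, 39a/50 ≤ z(m+1) − z(m)` (the crux's `Box` with the upper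
height bound deleted) uniform polytype stability FAILS.  Witness: `a = 47/50`, the fcc word,
uniform heights `H·m` with `H` large (in the window, force balanced by part I), `u = e₃·𝟙_{0}`.
The layers decouple (`tendsto_tsum_hr`, Tannery over the lattice at `H = 1`), and the basal layer
is a biaxially COMPRESSED triangular LJ membrane whose transverse stiffness
`Σ_{η≠0} V′(|η|)/|η|` is `< −3/2` (part IV-a, `tsum_ψpl_lt`: six bonds at `r = 0.94 < 1` give
`6·(−0.7375)`, the rest `≤ +2.6`), so `½·hessForm < 0 ≤ κ·nnForm`.  Physically: without a
ceiling on the layer spacing the "polytype" may be a stack of free membranes, and a compressed free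
LJ membrane buckles.  Numerically the crux at `a = 47/50` already fails at `H ≈ 1.5a`; the
disprover's Bloch scan puts the true edge of the height window at `h ≈ 0.91a` (`a = 1`).
[folklore] -/
theorem uniformPolytypeStability_false_without_heightUpper :
    ¬ UniformPolytypeStabilityOn fun a s z => 47 / 50 ≤ a ∧ a ≤ 1 ∧ IsHaggSeq s ∧
      ∀ m : ℤ, 39 / 50 * a ≤ z (m + 1) - z m := by
  rintro ⟨κ, hκ, h⟩
  obtain ⟨H, hH1, hneg⟩ := exists_height_tsum_hr_neg
  have hH0 : H ≠ 0 := by positivity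
  set L := fccLat a₀_ne_zero hH0
  have hS : Sites a₀ constHagg (zU H) = (L : Set E3) := sites_const_zU a₀_ne_zero hH0
  have hW : 47 / 50 ≤ a₀ ∧ a₀ ≤ 1 ∧ IsHaggSeq constHagg ∧
      ∀ m : ℤ, 39 / 50 * a₀ ≤ zU H (m + 1) - zU H m := by
    refine ⟨by unfold a₀; norm_num, by unfold a₀; norm_num, isHaggSeq_const, fun m => ?_⟩
    rw [zU_succ_sub]; unfold a₀; linarith
  have hF : ForceBalanced a₀ constHagg (zU H) :=
    forceBalanced_of_sites_eq L (finrank_fccLat _ _) hS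
  have hsupp : Function.support (uS e₃) ⊆ Sites a₀ constHagg (zU H) :=
    (support_uS e₃).trans (by
      intro p hp
      rw [Set.mem_singleton_iff] at hp
      subst hp
      rw [hS]
      exact L.zero_mem)
  have key := h a₀ constHagg (zU H) hW hF (uS e₃) (finite_support_uS e₃) hsupp
  rw [hessForm_e₃_eq hH1] at key
  have hnn := mul_nonneg hκ.le (nnForm_nonneg a₀ constHagg (zU H) (uS e₃))
  linarith

end HeightUpper

end Summit.AtomisticToContinuum.Crystallization.Theorems.UniformPolytypeStabilityNegative

end
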